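import Summits.RiemannHypothesis.RiemannHypothesis.Theses.ScrewLemmaKCoprofile
import Summits.RiemannHypothesis.RiemannHypothesis.Theorems.ScrewLemmaKCoprofileDefs
import Summits.RiemannHypothesis.RiemannHypothesis.Theorems.ScrewLemmaKCoprofileCalculus
import Summits.RiemannHypothesis.RiemannHypothesis.Theorems.ScrewLemmaKCoprofileMellin
import Summits.RiemannHypothesis.RiemannHypothesis.Theorems.ScrewLemmaKCoprofileSquareIntegrable
import HarnessLib

/-!
# Route `ScrewLemmaKCoprofile`, item `CoprofileMoments` (K2, stmt-RiemannHypothesis-21613)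

THREE MOMENTS of the lattice co-profile `Φ_g(t) = Σ_{n ≤ 1/t} g′(nt)/n` of an admissible
generator: `Φ_g ∈ L²(0,1)`, `∫₀¹ Φ_g = (π²/3)·h₀` (`h₀ = latticePlateau g = −g(0)/2`),
`∫₀¹ Φ_g(t)√t dt = 0`, `∫₀¹ Φ_g(t)·t dt = 0`.

Proof: square-integrability is `memLp_two_latticeCoprofile` (harmonic–log domination); the
moments come from the co-profile Mellin formula in the half-plane of absolute convergence
(`latticeCoprofile_moment`: `∫_{(0,1)} Φ_g t^a = Re ζ(a+2)·∫₀¹ g′(u)u^a du`, Müntz/Titchmarsh §2.11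
through the tree's `mellin_tsum_comp_mul_nat`) at `a = 0, 1/2, 1`, combined with the generator
moments `∫₀¹ g′ = −g(0)`, `∫₀¹ g′(u)√u du = 0`, `∫₀¹ g′(u)u du = 0` of the Calculus file and
`ζ(2) = π²/6` (Mathlib `riemannZeta_two`); the values `ζ(5/2)`, `ζ(3)` only multiply `0`.
RH-free real analysis; nothing here bears on the truth of RH.

Main result: `coprofileMoments_proof : …Theses.ScrewLemmaKCoprofile.CoprofileMoments` (the route
decl by name).
-/

set_option linter.dupNamespace false

noncomputable section

namespace Summit.RiemannHypothesis.RiemannHypothesis.Theorems.ScrewLemmaKCoprofile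

open MeasureTheory Set
open Summit.RiemannHypothesis.RiemannHypothesis.Theorems.IntegerScrew (SmoothSectorAdmissible
  latticePlateau)

/-- K2 (ii): `∫₀¹ Φ_g = (π²/3)·h₀`. [folklore] -/
theorem integral_latticeCoprofile {g : ℝ → ℝ} (hg : SmoothSectorAdmissible g) :
    ∫ t in Set.Ioo (0:ℝ) 1, latticeCoprofile g t = (Real.pi ^ 2 / 3) * latticePlateau g := by
  have h := latticeCoprofile_moment hg (le_refl (0:ℝ))
  have e1 : (∫ t in Set.Ioo (0:ℝ) 1, latticeCoprofile g t * t ^ (0:ℝ))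
      = ∫ t in Set.Ioo (0:ℝ) 1, latticeCoprofile g t :=
    setIntegral_congr_fun measurableSet_Ioo fun t _ => by rw [Real.rpow_zero, mul_one]
  have e2 : (∫ u in (0:ℝ)..1, deriv g u * u ^ (0:ℝ)) = ∫ u in (0:ℝ)..1, deriv g u :=
    intervalIntegral.integral_congr fun u _ => by rw [Real.rpow_zero, mul_one]
  have e3 : (riemannZeta (((0:ℝ) : ℂ) + 2)).re = Real.pi ^ 2 / 6 := by
    rw [show (((0:ℝ) : ℂ) + 2) = 2 by push_cast; ring, riemannZeta_two]
    norm_cast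
  rw [e1, e2, e3, integral_deriv_eq_neg_apply_zero hg] at h
  rw [h]
  unfold latticePlateau
  ring

/-- K2 (iii): `∫₀¹ Φ_g(t)√t dt = 0`. [folklore] -/
theorem integral_latticeCoprofile_mul_sqrt {g : ℝ → ℝ} (hg : SmoothSectorAdmissible g) :
    ∫ t in Set.Ioo (0:ℝ) 1, latticeCoprofile g t * Real.sqrt t = 0 := by
  have h := latticeCoprofile_moment hg (by norm_num : (0:ℝ) ≤ 1 / 2)
  have e1 : (∫ t in Set.Ioo (0:ℝ) 1, latticeCoprofile g t * t ^ (1 / 2 : ℝ))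
      = ∫ t in Set.Ioo (0:ℝ) 1, latticeCoprofile g t * Real.sqrt t :=
    setIntegral_congr_fun measurableSet_Ioo fun t _ => by rw [Real.sqrt_eq_rpow]
  rw [e1, integral_deriv_mul_sqrt_eq_zero hg, mul_zero] at h
  exact h

/-- K2 (iv): `∫₀¹ Φ_g(t)·t dt = 0`. [folklore] -/
theorem integral_latticeCoprofile_mul_id {g : ℝ → ℝ} (hg : SmoothSectorAdmissible g) :
    ∫ t in Set.Ioo (0:ℝ) 1, latticeCoprofile g t * t = 0 := by
  have h := latticeCoprofile_moment hg (zero_le_one : (0:ℝ) ≤ 1)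
  have e1 : (∫ t in Set.Ioo (0:ℝ) 1, latticeCoprofile g t * t ^ (1 : ℝ))
      = ∫ t in Set.Ioo (0:ℝ) 1, latticeCoprofile g t * t :=
    setIntegral_congr_fun measurableSet_Ioo fun t _ => by rw [Real.rpow_one]
  have e2 : (∫ u in (0:ℝ)..1, deriv g u * u ^ (1:ℝ)) = ∫ u in (0:ℝ)..1, deriv g u * u :=
    intervalIntegral.integral_congr fun u _ => by rw [Real.rpow_one]
  rw [e1, e2, integral_deriv_mul_id_eq_zero hg, mul_zero] at h
  exact h

/-- **Item `CoprofileMoments` (K2, stmt-RiemannHypothesis-21613)**, the route decl by name: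
for every admissible `g`, `Φ_g ∈ L²(0,1)` and its moments against `1, √t, t` are
`(π²/3)h₀, 0, 0`. RH-free. [folklore] -/
theorem coprofileMoments_proof :
    Summit.RiemannHypothesis.RiemannHypothesis.Theses.ScrewLemmaKCoprofile.CoprofileMoments := by
  unfold Summit.RiemannHypothesis.RiemannHypothesis.Theses.ScrewLemmaKCoprofile.CoprofileMoments
  intro g hg
  have e : (fun t : ℝ => ∑ n ∈ Finset.Icc 1 ⌊1 / t⌋₊, deriv g (n * t) / n) = latticeCoprofile g :=
    rfl
  refine ⟨?_, ?_, ?_, ?_⟩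
  · rw [e]; exact memLp_two_latticeCoprofile hg.1
  · exact integral_latticeCoprofile hg
  · exact integral_latticeCoprofile_mul_sqrt hg
  · exact integral_latticeCoprofile_mul_id hg

end Summit.RiemannHypothesis.RiemannHypothesis.Theorems.ScrewLemmaKCoprofile

end
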